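import Literature.AnabelianGeometry.EtaleTheta.Discharge.Sec2AutOverProofs
import Literature.AnabelianGeometry.EtaleTheta.Discharge.Sec2LiftingProofs
import Literature.AnabelianGeometry.EtaleTheta.Discharge.Sec2KLConjugacyProofs

/-!
# [EtTh] Cor 2.18 (iv), surjectivity — DISCHARGED modulo Cor 2.18 (i), (ii) and constant multiple
# rigidity (proof-only companion)

Mochizuki, *The Étale Theta Function …* [EtTh], Publ. RIMS 45 (2009), §2, Cor 2.18 (iv), PRIMS text
pp.61–62 (locators `p.N` = PDF pages; bib key `MochizukiEtTh2009`): "The surjectivity of this map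
follows by applying the 'functorial group-theoretic algorithm' of assertion (ii), in light of the
final portion of assertion (iii) … [the isomorphism] induces the identity on `Π•_Y`".

PROOF-ONLY companion of `ThetaRigidity.lean` (seat abc-iut-L2-t2), unit W2-L2-06 / Cor 2.18
(abc-iut-L2-t10). `RigidData.cor218_iv_surjective_of` : the named fact `Cor218_iv_surjective`
(every automorphism `γ` of the topological group `Π^tp_X` preserving `Π^tp_Y` lifts to an
automorphism of the model mono-theta environment over `γ|_{Π^tp_Y}`) FOLLOWS from
* `Cor218_i` (γ preserves `Π^tp_Ÿ` and `Δ_X`), `Cor218_ii` (models for different cocycles of the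
  collection are isomorphic over the identity),
* `hχ` : γ preserves the mod-`N` cyclotomic character (`χ(aug(γ x)) = χ(aug x)`; the content of
  Cor 2.18 (i) for the cyclotome `(l·Δ_Θ) ⊗ ℤ/N`),
* `hcoll` : the collection of theta cocycles is `γ`-stable up to a coefficient automorphism `ψ` and
  an inflated (Kummer) twist — constant multiple rigidity, Cor 2.19 (iii) / [EtTh] Thm 1.6 at
  level `N`.
Construction: `A₀ : (a, g) ↦ (ψ a, γ g)` normalises `D_Y` (`Sec2AutOverProofs`) and carries
`Im(s^Θ_η)` to a Kummer shift of `Im(s^Θ_{η''})`; compose with that shift and with the isomorphism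
`M(η'') ≃ M(η)` over the identity (`Cor218_ii`), which carries `Im(s^Θ_{η''})` onto a
`μ_N`-conjugate of `Im(s^Θ_η)`.
-/

namespace Literature.AnabelianGeometry.EtaleTheta

universe u

/-- Conjugating a subgroup by an element of the cyclotome does not change its `μ_N`-conjugacy
class. [cite: MochizukiEtTh2009, Def 2.10 p.44] -/
theorem CycEnvelope.muConjClass_map_conj_inMu {P G μ : Type*} [Group P] [Group G] [CommGroup μ]
    (aug : P →* G) (χ : G →* MulAut μ) (H : Subgroup (CycEnvelope aug χ)) (m : μ) :
    CycEnvelope.muConjClass aug χ (H.map (MulAut.conj (CycEnvelope.inMu aug χ m)).toMonoidHom) =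
      CycEnvelope.muConjClass aug χ H := by
  have key : ∀ a b : μ,
      (H.map (MulAut.conj (CycEnvelope.inMu aug χ b)).toMonoidHom).map
          (MulAut.conj (CycEnvelope.inMu aug χ a)).toMonoidHom =
        H.map (MulAut.conj (CycEnvelope.inMu aug χ (a * b))).toMonoidHom := by
    intro a b
    rw [Subgroup.map_map]
    congr 1
    refine MonoidHom.ext fun x => ?_
    simp only [MonoidHom.coe_comp, Function.comp_apply, MulEquiv.coe_toMonoidHom,
      MulAut.conj_apply, map_mul, MulAut.mul_apply, mul_assoc]
  ext K
  constructor
  · rintro ⟨a, rfl⟩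
    exact ⟨a * m, key a m⟩
  · rintro ⟨a, rfl⟩
    refine ⟨a * m⁻¹, ?_⟩
    rw [key, inv_mul_cancel_right]

/-- Def 2.13 (ii) iso constructor, version with a `μ_N`-offset: `c` carries `Im(s^Θ_η)` onto a
`μ_N`-conjugate of `Im(s^Θ_{η'})`. [cite: MochizukiEtTh2009, Def 2.13(ii) p.47] -/
theorem ThetaEnvData.exists_modelIso_of_aut'' {N : ℕ+} (T : ThetaEnvData.{u} N)
    {η η' : T.PiYdd → T.mu} (hη : η ∈ T.thetaCocycles)
    (hη' : η' ∈ T.thetaCocycles) (c : contMulAut T.env)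
    (hD : T.DY.map (MulAut.conj (TopOut.mk _ c)).toMonoidHom = T.DY)
    (hμ : ∀ a, ∃ b, (c : MulAut T.env) (CycEnvelope.inMu T.augY T.chi a) =
      CycEnvelope.inMu T.augY T.chi b)
    (hμ' : ∀ b, ∃ a, (c : MulAut T.env) (CycEnvelope.inMu T.augY T.chi a) =
      CycEnvelope.inMu T.augY T.chi b) (m : T.mu)
    (hs : (T.sTheta hη).range.map (c : MulAut T.env).toMonoidHom =
      (T.sTheta hη').range.map (MulAut.conj (CycEnvelope.inMu T.augY T.chi m)).toMonoidHom) :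
    ∃ α : (T.modelMono hη).Iso (T.modelMono hη'), ∀ x, α.e x = (c : MulAut T.env) x := by
  refine ⟨{ e := ContinuousMulEquiv.mk (c : MulAut T.env) c.2.1 c.2.2
            map_D := ?_
            map_sTheta := ?_ }, fun x => rfl⟩
  · change T.DY.map _ = T.DY
    rw [TopOut.transport_mk_eq_conj]
    exact hD
  · change (fun H : Subgroup T.env => H.map (c : MulAut T.env).toMonoidHom) ''
        CycEnvelope.muConjClass T.augY T.chi (T.sTheta hη).range =
      CycEnvelope.muConjClass T.augY T.chi (T.sTheta hη').range
    rw [CycEnvelope.image_muConjClass_eq_of_perm T.augY T.chi _ hμ hμ', hs,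
      CycEnvelope.muConjClass_map_conj_inMu]

namespace RigidData

variable {N : ℕ+} {l : ℕ} (R : RigidData.{u} N l)

/-- Automorphisms of the cyclic group `μ_N` commute with the cyclotomic character (both are power
maps). [cite: MochizukiEtTh2009, Cor 2.18(iv) p.61] -/
theorem mulEquiv_comm_chi (ψ : R.mu ≃* R.mu) (σ : R.G) (a : R.mu) :
    ψ (R.chi σ a) = R.chi σ (ψ a) := by
  haveI := R.mu_cyclic
  obtain ⟨m, hm⟩ := MonoidHom.map_cyclic ψ.toMonoidHom
  have h1 : ψ (R.chi σ a) = (R.chi σ a) ^ m := hm _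
  have h2 : ψ a = a ^ m := hm a
  rw [h1, h2, map_zpow]

/-- **Cor 2.18 (iv), surjectivity, DISCHARGED modulo Cor 2.18 (i), (ii), the `γ`-invariance of the
cyclotomic character and constant multiple rigidity of the theta collection.**
[cite: MochizukiEtTh2009, Cor 2.18(iv) p.61] -/
theorem cor218_iv_surjective_of (h218i : R.Cor218_i) (h218ii : R.Cor218_ii)
    (hχ : ∀ γ : R.PiX ≃ₜ* R.PiX, R.PiY.map γ.toMulEquiv.toMonoidHom = R.PiY →
      ∀ x : R.PiX, R.chi (R.aug (γ x)) = R.chi (R.aug x))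
    (hcoll : ∀ γ : R.PiX ≃ₜ* R.PiX, R.PiY.map γ.toMulEquiv.toMonoidHom = R.PiY →
      ∃ ψ : R.mu ≃* R.mu, ∀ (η : R.PiYdd → R.mu), η ∈ R.thetaCocycles →
        ∃ (η'' : R.PiYdd → R.mu) (_ : η'' ∈ R.thetaCocycles) (c : R.G → R.mu)
          (hc : CycEnvelope.IsEnvCocycle R.augY R.chi (c ∘ R.augY))
          (_ : CycEnvelope.shift hc ∈ contMulAut R.env),
          ∀ d d' : R.PiYdd, γ (d : R.PiX) = d' → ψ (η d) = η'' d' * c (R.augY (R.inclYdd d'))) :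
    R.Cor218_iv_surjective := by
  intro η hη γ hγ
  obtain ⟨hγY, hγdd, hγker, -, -, -⟩ := h218i γ
  obtain ⟨ψ, hψcoll⟩ := hcoll γ hγ
  obtain ⟨η'', hη'', c, hc, hcc, hηc⟩ := hψcoll η hη
  have hψ : ∀ σ a, ψ (R.chi σ a) = R.chi σ (ψ a) := R.mulEquiv_comm_chi ψ
  have hψ' : ∀ σ a, ψ.symm (R.chi σ a) = R.chi σ (ψ.symm a) := R.mulEquiv_comm_chi ψ.symm
  have hχγ := hχ γ hγ
  have hχγ' : ∀ x : R.PiX, R.chi (R.aug (γ.symm x)) = R.chi (R.aug x) := fun x => by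
    rw [← hχγ (γ.symm x), ContinuousMulEquiv.apply_symm_apply]
  -- transport of membership along `γ`, `γ⁻¹`
  have fwd : ∀ (H : Subgroup R.PiX), H.map γ.toMulEquiv.toMonoidHom = H →
      (∀ g ∈ H, γ g ∈ H) ∧ ∀ g ∈ H, γ.symm g ∈ H := by
    intro H hH
    refine ⟨fun g hg => ?_, fun g hg => ?_⟩
    · rw [← hH]; exact ⟨g, hg, rfl⟩
    · have hg' : g ∈ H.map γ.toMulEquiv.toMonoidHom := by rw [hH]; exact hg
      obtain ⟨g₀, hg₀, hg₀eq⟩ := hg'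
      have : γ.symm g = g₀ := by
        rw [← hg₀eq]; exact γ.symm_apply_apply g₀
      rw [this]; exact hg₀
  obtain ⟨hY, hY'⟩ := fwd _ hγY
  obtain ⟨hdd, hdd'⟩ := fwd _ hγdd
  obtain ⟨hker, hker'⟩ := fwd _ hγker
  -- the automorphism `A₀ : (a, g) ↦ (ψ a, γ g)`
  let A₀ : MulAut R.env :=
    { toFun := fun x => ⟨ψ x.left, ⟨γ (x.right : R.PiX), hY _ x.right.2⟩⟩
      invFun := fun x => ⟨ψ.symm x.left, ⟨γ.symm (x.right : R.PiX), hY' _ x.right.2⟩⟩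
      left_inv := fun x => by
        ext
        · simp
        · simp
      right_inv := fun x => by
        ext
        · simp
        · simp
      map_mul' := fun x y => by
        ext
        · simp only [SemidirectProduct.mul_left, map_mul, MonoidHom.coe_comp,
            Function.comp_apply, Subgroup.coe_subtype]
          rw [hψ, hχγ]
        · simp }
  have hl : ∀ x : R.env, (A₀ x).left = ψ x.left := fun x => rfl
  have hr : ∀ x : R.env, (((A₀ x).right : R.PiY) : R.PiX) = γ (x.right : R.PiX) := fun x => rfl
  -- continuity of `A₀`
  have hlc : Continuous fun x : R.env => x.left :=
    (continuous_fst.comp continuous_induced_dom :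
      Continuous (Prod.fst ∘ fun x : R.env => (x.left, x.right)))
  have hrc : Continuous fun x : R.env => ((x.right : R.PiY) : R.PiX) :=
    continuous_subtype_val.comp (continuous_snd.comp continuous_induced_dom :
      Continuous (Prod.snd ∘ fun x : R.env => (x.left, x.right)))
  have hA₀c : A₀ ∈ contMulAut R.env := by
    refine ⟨?_, ?_⟩
    · refine continuous_induced_rng.2 ?_
      change Continuous fun x : R.env =>
        ((ψ x.left, (⟨γ (x.right : R.PiX), hY _ x.right.2⟩ : R.PiY)) : R.mu × R.PiY)
      exact ((continuous_of_discreteTopology (f := fun a : R.mu => ψ a)).comp hlc).prodMk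
        ((γ.continuous.comp hrc).subtype_mk _)
    · refine continuous_induced_rng.2 ?_
      change Continuous fun x : R.env =>
        ((ψ.symm x.left, (⟨γ.symm (x.right : R.PiX), hY' _ x.right.2⟩ : R.PiY)) : R.mu × R.PiY)
      exact ((continuous_of_discreteTopology (f := fun a : R.mu => ψ.symm a)).comp hlc).prodMk
        ((γ.symm.continuous.comp hrc).subtype_mk _)
  set cA : contMulAut R.env := ⟨A₀, hA₀c⟩ with hcA
  -- `τ`, `τ'`: the maps induced by `γ⁻¹`, `γ` on `G_K` (via `aug` surjective and `Δ`-invariance)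
  have hτex : ∀ (e : R.PiX ≃ₜ* R.PiX), (∀ k ∈ R.aug.ker, e k ∈ R.aug.ker) →
      ∃ τ : R.G → R.G, ∀ g : R.PiY, R.aug (e (g : R.PiX)) = τ (R.augY g) := by
    intro e he
    refine ⟨fun σ => R.aug (e (Classical.choose (R.aug_surjective σ))), fun g => ?_⟩
    have hp := Classical.choose_spec (R.aug_surjective (R.augY g))
    set p := Classical.choose (R.aug_surjective (R.augY g))
    have hk : p⁻¹ * (g : R.PiX) ∈ R.aug.ker := by
      rw [MonoidHom.mem_ker, map_mul, map_inv, hp]; exact inv_mul_cancel _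
    have : (g : R.PiX) = p * (p⁻¹ * g) := by group
    change R.aug (e (g : R.PiX)) = R.aug (e p)
    rw [this, map_mul, map_mul, (he _ hk), mul_one]
  obtain ⟨τ, hτ⟩ := hτex γ.symm hker'
  obtain ⟨τ', hτ'⟩ := hτex γ hker
  -- `A₀` normalises `D_Y`
  obtain ⟨hl', hr'⟩ := ThetaEnvData.inv_shape cA γ ψ hl hr
  have h1 := ThetaEnvData.DY_conj_gen_of_shape cA γ ψ hl hr hψ hχγ τ hτ
  have h2' := ThetaEnvData.DY_conj_gen_of_shape cA⁻¹ γ.symm ψ.symm hl' hr' hψ' hχγ' τ'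
    (fun g => by rw [ContinuousMulEquiv.symm_symm]; exact hτ' g)
  have hD : R.DY.map (MulAut.conj (TopOut.mk _ cA)).toMonoidHom = R.DY := by
    refine R.toThetaEnvData.DY_map_conj_eq_of_generators cA h1 fun d hd => ?_
    have h := h2' d hd
    rwa [map_inv, inv_inv] at h
  -- the Kummer shift `S = α_{(c∘aug)⁻¹}` and the transport of `Im(s^Θ_η)`
  have hS : CycEnvelope.shift hc.inv ∈ contMulAut R.env := by
    rw [← CycEnvelope.shift_inv hc]; exact inv_mem hcc
  set cS : contMulAut R.env := ⟨_, hS⟩ with hcS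
  have hcSinv : cS = (⟨_, hcc⟩ : contMulAut R.env)⁻¹ := Subtype.ext (CycEnvelope.shift_inv hc).symm
  have hst : ∀ d : R.PiYdd, A₀ (R.toThetaEnvData.sTheta hη d) =
      CycEnvelope.shift hc.inv (R.toThetaEnvData.sTheta hη'' ⟨γ (d : R.PiX), hdd _ d.2⟩) := by
    intro d
    have hd := hηc d ⟨γ (d : R.PiX), hdd _ d.2⟩ rfl
    ext
    · change ψ (η d)⁻¹ = (η'' _)⁻¹ * (c (R.augY (R.inclYdd _)))⁻¹
      rw [map_inv, hd, mul_inv]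
    · rfl
  have hrange : (R.toThetaEnvData.sTheta hη).range.map (cA : MulAut R.env).toMonoidHom =
      (R.toThetaEnvData.sTheta hη'').range.map (cS : MulAut R.env).toMonoidHom := by
    ext y
    constructor
    · rintro ⟨_, ⟨d, rfl⟩, rfl⟩
      exact ⟨_, ⟨⟨γ (d : R.PiX), hdd _ d.2⟩, rfl⟩, (hst d).symm⟩
    · rintro ⟨_, ⟨d', rfl⟩, rfl⟩
      refine ⟨_, ⟨⟨γ.symm (d' : R.PiX), hdd' _ d'.2⟩, rfl⟩, ?_⟩
      change A₀ _ = _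
      rw [hst]
      change _ = CycEnvelope.shift hc.inv (R.toThetaEnvData.sTheta hη'' d')
      congr 2
      apply Subtype.ext
      exact ContinuousMulEquiv.apply_symm_apply γ (d' : R.PiX)
  -- the isomorphism `e : M(η'') ≃ M(η)` over the identity, and its `μ_N`-offset `m`
  obtain ⟨e, he⟩ := h218ii η'' η hη'' hη
  set ce : contMulAut R.env := ⟨e.e.toMulEquiv, e.e.continuous, e.e.symm.continuous⟩ with hce
  have hDe : R.DY.map (MulAut.conj (TopOut.mk _ ce)).toMonoidHom = R.DY := by
    have h := e.map_D
    change R.DY.map (TopOut.transport e.e) = R.DY at h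
    rwa [TopOut.transport_eq_conj] at h
  have hecl : (R.toThetaEnvData.sTheta hη'').range.map (ce : MulAut R.env).toMonoidHom ∈
      CycEnvelope.muConjClass R.augY R.chi (R.toThetaEnvData.sTheta hη).range := by
    have h := e.map_sTheta
    change (fun H : Subgroup R.env => H.map e.e.toMulEquiv.toMonoidHom) ''
        CycEnvelope.muConjClass R.augY R.chi (R.toThetaEnvData.sTheta hη'').range =
      CycEnvelope.muConjClass R.augY R.chi (R.toThetaEnvData.sTheta hη).range at h
    rw [← h]
    exact ⟨_, CycEnvelope.self_mem_muConjClass _ _ _, rfl⟩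
  obtain ⟨m, hm⟩ := hecl
  have heright : ∀ y, (e.e y).right = y.right := he
  have heright' : ∀ y, (e.e.symm y).right = y.right := fun y => by
    have h := heright (e.e.symm y)
    rw [ContinuousMulEquiv.apply_symm_apply] at h
    exact h.symm
  -- the total automorphism
  set ct : contMulAut R.env := ce * cS⁻¹ * cA with hct
  have hDt : R.DY.map (MulAut.conj (TopOut.mk _ ct)).toMonoidHom = R.DY := by
    rw [hct, map_mul (TopOut.mk _), map_mul (TopOut.mk _), map_inv (TopOut.mk _)]
    have hDS : R.DY.map (MulAut.conj (TopOut.mk _ cS)).toMonoidHom = R.DY := by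
      rw [hcSinv, map_inv (TopOut.mk _)]
      exact (subgroup_map_conj_mul_inv _ (R.toThetaEnvData.DY_map_conj_shift hc hcc)
        (R.toThetaEnvData.DY_map_conj_shift hc hcc)).2
    exact (subgroup_map_conj_mul_inv _
      (subgroup_map_conj_mul_inv _ hDe (subgroup_map_conj_mul_inv _ hDS hDS).2).1 hD).1
  -- action on `μ_N`
  have hAμ : ∀ a, A₀ (CycEnvelope.inMu R.augY R.chi a) = CycEnvelope.inMu R.augY R.chi (ψ a) := by
    intro a; ext
    · rfl
    · change γ ((1 : R.PiY) : R.PiX) = ((1 : R.PiY) : R.PiX)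
      rw [Subgroup.coe_one, map_one]
  have hSμ : ∀ a, (cS : MulAut R.env)⁻¹ (CycEnvelope.inMu R.augY R.chi a) =
      CycEnvelope.inMu R.augY R.chi a := by
    intro a
    rw [hcSinv, Subgroup.coe_inv, inv_inv]
    exact CycEnvelope.shift_inMu hc a
  have heμ : ∀ a, e.e (CycEnvelope.inMu R.augY R.chi a) =
      CycEnvelope.inMu R.augY R.chi (e.e (CycEnvelope.inMu R.augY R.chi a)).left := by
    intro a; ext
    · simp
    · rw [heright]; simp
  have heμ' : ∀ a, e.e.symm (CycEnvelope.inMu R.augY R.chi a) =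
      CycEnvelope.inMu R.augY R.chi (e.e.symm (CycEnvelope.inMu R.augY R.chi a)).left := by
    intro a; ext
    · simp
    · rw [heright']; simp
  have hμ : ∀ a, ∃ b, (ct : MulAut R.env) (CycEnvelope.inMu R.augY R.chi a) =
      CycEnvelope.inMu R.augY R.chi b := by
    intro a
    refine ⟨(e.e (CycEnvelope.inMu R.augY R.chi (ψ a))).left, ?_⟩
    rw [hct]
    change e.e ((cS : MulAut R.env)⁻¹ (A₀ _)) = _
    rw [hAμ, hSμ]
    exact heμ (ψ a)
  have hμ' : ∀ b, ∃ a, (ct : MulAut R.env) (CycEnvelope.inMu R.augY R.chi a) =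
      CycEnvelope.inMu R.augY R.chi b := by
    intro b
    refine ⟨ψ.symm (e.e.symm (CycEnvelope.inMu R.augY R.chi b)).left, ?_⟩
    rw [hct]
    change e.e ((cS : MulAut R.env)⁻¹ (A₀ _)) = _
    rw [hAμ, MulEquiv.apply_symm_apply, hSμ, ← heμ', ContinuousMulEquiv.apply_symm_apply]
  -- action on `Im(s^Θ_η)`
  have hone : ∀ (H : Subgroup R.env) (A : MulAut R.env),
      (H.map A.toMonoidHom).map A⁻¹.toMonoidHom = H := by
    intro H A
    rw [← subgroup_map_mulAut_mul, inv_mul_cancel]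
    exact Subgroup.map_id H
  have hs : (R.toThetaEnvData.sTheta hη).range.map (ct : MulAut R.env).toMonoidHom =
      (R.toThetaEnvData.sTheta hη).range.map
        (MulAut.conj (CycEnvelope.inMu R.augY R.chi m)).toMonoidHom := by
    rw [hct, Subgroup.coe_mul, Subgroup.coe_mul, Subgroup.coe_inv, subgroup_map_mulAut_mul, hrange,
      subgroup_map_mulAut_mul, hone]
    exact hm
  -- the total automorphism lies over `γ`
  have hproj : ∀ x, (((CycEnvelope.proj R.augY R.chi ((ct : MulAut R.env) x) : R.PiY) : R.PiX)) =
      γ ((CycEnvelope.proj R.augY R.chi x : R.PiY) : R.PiX) := by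
    intro x
    rw [hct]
    change (((e.e (((cS : MulAut R.env)⁻¹) (A₀ x))).right : R.PiY) : R.PiX) = γ (x.right : R.PiX)
    have h2 : ∀ y : R.env, ((cS : MulAut R.env)⁻¹ y).right = y.right := fun y => by
      rw [hcSinv, Subgroup.coe_inv, inv_inv]
      rfl
    rw [heright, h2]
    rfl
  obtain ⟨α, hα⟩ := R.toThetaEnvData.exists_modelIso_of_aut'' hη hη ct hDt hμ hμ' m hs
  exact ⟨α, fun x => by rw [hα]; exact hproj x⟩

end RigidData

end Literature.AnabelianGeometry.EtaleTheta
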